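import Mathlib
import Literature.Analysis.FluidPDE.PoincareBall
import Literature.Analysis.FluidPDE.SuitableWeakRescaling
import Literature.Analysis.FluidPDE.SereginSverakPressureProofs
import Literature.Analysis.FluidPDE.BlowupFarField
import Literature.Analysis.FluidPDE.SereginSverak2002VertexBlowupLimit
import Literature.Analysis.FluidPDE.NSSuitableESS
import Literature.Analysis.FluidPDE.ESSLocalHolderHolds
import Literature.Analysis.FluidPDE.ESSLocalHolderBlowupLimit
import Literature.Analysis.FluidPDE.LocalTypeIScaling
import Literature.Analysis.FluidPDE.LocalTypeIPersistenceHolds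
import Literature.Analysis.FluidPDE.LocalTypeICongr
import Literature.Analysis.FluidPDE.LeraySuitableWeakSolutions
import Literature.Analysis.FluidPDE.NSWeakStrongUniquenessHolds
import Literature.Analysis.FluidPDE.TaoLocalisationHolds
import Literature.Analysis.FluidPDE.TaoLocalisationProofs
import Literature.Analysis.FluidPDE.KatoMaximalTimeSingular
import Literature.Analysis.FluidPDE.TypeIRateScaledEnergyBound
import Literature.Analysis.FluidPDE.SereginSverak2002PressureLowerBoundProofs
import Literature.Analysis.FluidPDE.NSLerayHopfABCScaling
import Literature.Analysis.FluidPDE.NSTimeRescaleClassical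
import Literature.Analysis.FluidPDE.NSViscosityRescaling
import Literature.Analysis.FluidPDE.TypeIAncientMildRescale
import Literature.Analysis.FluidPDE.SelfSimilar
import Literature.Analysis.FluidPDE.AncientAxisymmetricTypeILiouville
import Literature.Analysis.FluidPDE.CKNLocalEnergyEstimate
import Literature.Analysis.FluidPDE.CKNPressureEstimate
import Literature.Analysis.FluidPDE.CKNUnforcedOneScaleRRS
import Literature.Analysis.FluidPDE.CKNLocalRegularityRRSPressure
import Literature.Analysis.FluidPDE.RusinSverakSingularityStabilityEpsilon
import Literature.Analysis.FluidPDE.CKNScalingExtras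
import Literature.Analysis.FluidPDE.CKNLocalRegularityRRSStep3
import Literature.Analysis.FluidPDE.PineauVicolOneSliceProofs
import Literature.Analysis.FluidPDE.TsaiLocalEnergyProofs
import Summits.NavierStokesRegularity.NavierStokesRegularity.Theorems.TypeIQuarterGateScarEnvelopeTypeIRateFloorEngines

/-!
# Rate floor for crux `ScarEnvelopeTypeI` (stmt-NavierStokesRegularity-23843) — Part O3–O4: the real iteration scheme; the constants and the explicit floor `ε_*(I)`

Part O3–O4 of the ROUND-35 plate: O3 `scheme` — the finite CKN iteration in the box `A, E ≤ I` (elementary real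
analysis); O4 the constants chosen ONCE from the tree's existential CKN constants (`master_pack`/`press_pack`/`reg_pack`,
`cT c1 C4 κ₅ κ₆ ε₀ C₀`, the ratio `θ₀`, the step coefficients `a₁ a₂ a₃ b₁`, `τ₀`, `K₁`) and THE EXPLICIT FLOOR
`epsFloor I = ε_*(I)` with `epsFloor_pos`, `epsFloor_spec`.

PROVENANCE: declaration texts VERBATIM from the HOME plate of the instrument seat nsreg-p3 g26 (cell
`pub/ns-regularity-ideate`): `round-35/Tangent35prep.lean` v9 (sha16 `ce6f8ea4cb093fca`; = ROUND-34 plate v8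
`84f56c3bc8f4da24` VERBATIM + Part O), scored PASS by referee ref3 g26 (`SCORE-p3-ROUND-35-0828.md`); the author cannot
write under `Theorems/` (`perm.theorems-prover-only`); landed by the prover ns-es-p1 g5 as landing hand of record
(director-ns DIRECTOR-NS #237 (3)), split into ≤ 400-line modules, namespace
`Summit.NavierStokesRegularity.NavierStokesRegularity.Cruxes.ScarEnvelopeTypeI.ZoomDictionary.Floor` for the plate's `NsregP3.R35O` (and `Summit.NavierStokesRegularity.NavierStokesRegularity.Cruxes.ScarEnvelopeTypeI.ZoomDictionary`
for its `NsregP3.R30P`, as in the 26 landed dictionary / satellite-tower modules), `E3` spelled out, one-line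
docstrings added where the plate had none.  `--supports stmt-NavierStokesRegularity-23843 --as helper`.

HONEST FRAMING: an effective ε-regularity INSTRUMENT inside the Type-I box, proved from the tree's CKN engines
(`localEnergy_master`, `pressureEstimate_holds`, `RRS2016.theorem15_3_holds`) — no compactness, no Liouville theorem,
no hypothesis taken from print; it bears on the crux `TypeIQuarterGate.ScarEnvelopeTypeI` (item 23843) only through the
satellite-tower census (Part N's `SmallRateRegularity` hypothesis is discharged on bounded sub-classes).  NO open
statement is proved — 23843, its parent `QuarterLawTypeI`, the route and Navier–Stokes regularity are OPEN.
-/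

-- the summit-side namespace repeats a component by design (single-conjunct summit, D-0017)
set_option linter.dupNamespace false

open MeasureTheory Set Metric Filter Topology
open scoped ENNReal NNReal InnerProductSpace
open Literature.Analysis.FluidPDE

namespace Summit.NavierStokesRegularity.NavierStokesRegularity.Cruxes.ScarEnvelopeTypeI.ZoomDictionary.Floor

/-! ## O3. The real iteration scheme (all exponents sublinear; `A, E ≤ I` box the recursion) -/

/-- **O3 (the scheme).**  Sequences `A, E, C, D ≥ 0` along the scales `θ₀^k r₀` with
`A, E ≤ I`, `C ≤ 2 ε I` (the rate, O1), the master `E`-step and the pressure `D`-step (contraction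
`1/2`): after `k₁ + 1 + k₂` steps `C + D ≤ τ`, where `k₁` only depends on a bound for `D 0`,
`k₂` only on `(I, b, τ)`, and the two smallness conditions on `ε` only on `(I, a₁, a₂, a₃, b, τ)`. -/
theorem scheme {I ε τ a₁ a₂ a₃ b : ℝ} (hI : 1 ≤ I) (hε0 : 0 ≤ ε) (hε1 : ε ≤ 1)
    (ha₁ : 0 ≤ a₁) (ha₂ : 0 ≤ a₂) (ha₃ : 0 ≤ a₃) (hb : 0 ≤ b)
    {A E C D : ℕ → ℝ}
    (hA0 : ∀ k, 0 ≤ A k) (hE0 : ∀ k, 0 ≤ E k) (hC0 : ∀ k, 0 ≤ C k) (hD0 : ∀ k, 0 ≤ D k)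
    (hA : ∀ k, A k ≤ I) (hE : ∀ k, E k ≤ I) (hC : ∀ k, C k ≤ 2 * ε * I)
    (stepE : ∀ k, E (k + 1) ≤ a₁ * C k ^ (2 / 3 : ℝ) +
        a₂ * (A k * E k) ^ (1 / 2 : ℝ) * C k ^ (1 / 3 : ℝ) + a₃ * D k ^ (2 / 3 : ℝ) * C k ^ (1 / 3 : ℝ))
    (stepD : ∀ k, D (k + 1) ≤ b * A k ^ (3 / 4 : ℝ) * E k ^ (3 / 4 : ℝ) + D k / 2)
    {k₁ k₂ : ℕ} (hk₁ : D 0 ≤ 2 ^ k₁ * (b * I ^ (3 / 2 : ℝ)))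
    (hk₂ : 3 * b * I ^ (3 / 2 : ℝ) ≤ 2 ^ k₂ * (τ / 3))
    (hεI : 2 * ε * I ≤ τ / 3)
    (hεK : 2 * b * I ^ (3 / 4 : ℝ) * ((2 * ε * I) ^ (1 / 3 : ℝ) *
        (a₁ * (2 * I) ^ (1 / 3 : ℝ) + a₂ * I +
          a₃ * (3 * b * I ^ (3 / 2 : ℝ)) ^ (2 / 3 : ℝ))) ^ (3 / 4 : ℝ) ≤ τ / 3) :
    C (k₁ + 1 + k₂) + D (k₁ + 1 + k₂) ≤ τ := by
  have hIpos : 0 < I := by linarith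
  set Dbar := 3 * b * I ^ (3 / 2 : ℝ) with hDbar
  set K₁ := a₁ * (2 * I) ^ (1 / 3 : ℝ) + a₂ * I + a₃ * Dbar ^ (2 / 3 : ℝ) with hK₁
  set Ebar := (2 * ε * I) ^ (1 / 3 : ℝ) * K₁ with hEbar
  have hI32 : I ^ (3 / 4 : ℝ) * I ^ (3 / 4 : ℝ) = I ^ (3 / 2 : ℝ) := by
    rw [← Real.rpow_add hIpos]; norm_num
  have hbI : 0 ≤ b * I ^ (3 / 2 : ℝ) := mul_nonneg hb (Real.rpow_nonneg hIpos.le _)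
  have hDbar0 : 0 ≤ Dbar := by rw [hDbar]; positivity
  have hK₁0 : 0 ≤ K₁ := by rw [hK₁]; positivity
  have hEbar0 : 0 ≤ Ebar := by rw [hEbar]; positivity
  -- the `A^{3/4} E^{3/4}` box
  have hAE34 : ∀ k, A k ^ (3 / 4 : ℝ) * E k ^ (3 / 4 : ℝ) ≤ I ^ (3 / 2 : ℝ) := fun k => by
    rw [← hI32]
    exact mul_le_mul (Real.rpow_le_rpow (hA0 k) (hA k) (by norm_num))
      (Real.rpow_le_rpow (hE0 k) (hE k) (by norm_num)) (Real.rpow_nonneg (hE0 k) _)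
      (Real.rpow_nonneg hIpos.le _)
  -- L1: geometric decay of `D` into the box
  have L1 : ∀ k, D k ≤ D 0 / 2 ^ k + 2 * (b * I ^ (3 / 2 : ℝ)) := by
    intro k
    induction k with
    | zero => simp; positivity
    | succ k ih =>
      calc D (k + 1) ≤ b * A k ^ (3 / 4 : ℝ) * E k ^ (3 / 4 : ℝ) + D k / 2 := stepD k
        _ ≤ b * I ^ (3 / 2 : ℝ) + (D 0 / 2 ^ k + 2 * (b * I ^ (3 / 2 : ℝ))) / 2 := by
            rw [mul_assoc]
            gcongr
            exact hAE34 k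
        _ = D 0 / 2 ^ (k + 1) + 2 * (b * I ^ (3 / 2 : ℝ)) := by rw [pow_succ]; ring
  -- L2: after `k₁` steps `D ≤ Dbar`
  have L2 : ∀ j, D (k₁ + j) ≤ Dbar := by
    intro j
    have h1 := L1 (k₁ + j)
    have h2 : D 0 / 2 ^ (k₁ + j) ≤ b * I ^ (3 / 2 : ℝ) := by
      rw [div_le_iff₀ (by positivity)]
      calc D 0 ≤ 2 ^ k₁ * (b * I ^ (3 / 2 : ℝ)) := hk₁
        _ ≤ 2 ^ (k₁ + j) * (b * I ^ (3 / 2 : ℝ)) := by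
            gcongr
            · norm_num
            · exact Nat.le_add_right _ _
        _ = b * I ^ (3 / 2 : ℝ) * 2 ^ (k₁ + j) := by ring
    rw [hDbar]; linarith
  -- L3: from then on `E ≤ Ebar`
  have hCle : ∀ k, C k ^ (1 / 3 : ℝ) ≤ (2 * ε * I) ^ (1 / 3 : ℝ) := fun k =>
    Real.rpow_le_rpow (hC0 k) (hC k) (by norm_num)
  have h2I : (2 * ε * I) ^ (1 / 3 : ℝ) ≤ (2 * I) ^ (1 / 3 : ℝ) :=
    Real.rpow_le_rpow (by positivity) (by nlinarith) (by norm_num)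
  have L3 : ∀ j, E (k₁ + j + 1) ≤ Ebar := by
    intro j
    set k := k₁ + j with hk
    have hC23 : C k ^ (2 / 3 : ℝ) = C k ^ (1 / 3 : ℝ) * C k ^ (1 / 3 : ℝ) := by
      rw [← Real.rpow_add_of_nonneg (hC0 k) (by norm_num) (by norm_num)]; norm_num
    have hII : (I * I) ^ (1 / 2 : ℝ) = I := by
      rw [← Real.sqrt_eq_rpow, Real.sqrt_mul_self hIpos.le]
    have hAEk : (A k * E k) ^ (1 / 2 : ℝ) ≤ I := by
      calc (A k * E k) ^ (1 / 2 : ℝ) ≤ (I * I) ^ (1 / 2 : ℝ) :=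
            Real.rpow_le_rpow (mul_nonneg (hA0 k) (hE0 k))
              (mul_le_mul (hA k) (hE k) (hE0 k) hIpos.le) (by norm_num)
        _ = I := hII
    have hDk : D k ^ (2 / 3 : ℝ) ≤ Dbar ^ (2 / 3 : ℝ) :=
      Real.rpow_le_rpow (hD0 k) (L2 j) (by norm_num)
    calc E (k + 1) ≤ a₁ * C k ^ (2 / 3 : ℝ) +
        a₂ * (A k * E k) ^ (1 / 2 : ℝ) * C k ^ (1 / 3 : ℝ) + a₃ * D k ^ (2 / 3 : ℝ) * C k ^ (1 / 3 : ℝ) :=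
          stepE k
      _ = C k ^ (1 / 3 : ℝ) * (a₁ * C k ^ (1 / 3 : ℝ) + a₂ * (A k * E k) ^ (1 / 2 : ℝ) +
            a₃ * D k ^ (2 / 3 : ℝ)) := by rw [hC23]; ring
      _ ≤ (2 * ε * I) ^ (1 / 3 : ℝ) * (a₁ * (2 * I) ^ (1 / 3 : ℝ) + a₂ * I + a₃ * Dbar ^ (2 / 3 : ℝ)) := by
          have hT1 : a₁ * C k ^ (1 / 3 : ℝ) ≤ a₁ * (2 * I) ^ (1 / 3 : ℝ) :=
            mul_le_mul_of_nonneg_left ((hCle k).trans h2I) ha₁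
          have hT2 : a₂ * (A k * E k) ^ (1 / 2 : ℝ) ≤ a₂ * I := mul_le_mul_of_nonneg_left hAEk ha₂
          have hT3 : a₃ * D k ^ (2 / 3 : ℝ) ≤ a₃ * Dbar ^ (2 / 3 : ℝ) :=
            mul_le_mul_of_nonneg_left hDk ha₃
          have hnn : 0 ≤ a₁ * C k ^ (1 / 3 : ℝ) + a₂ * (A k * E k) ^ (1 / 2 : ℝ) +
              a₃ * D k ^ (2 / 3 : ℝ) := by
            have := hA0 k; have := hE0 k; have := hD0 k; have := hC0 k; positivity
          exact mul_le_mul (hCle k) (add_le_add (add_le_add hT1 hT2) hT3) hnn (by positivity)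
      _ = Ebar := by rw [hEbar, hK₁]
  -- L4: second geometric decay of `D`
  have L4 : ∀ j, D (k₁ + 1 + j) ≤ Dbar / 2 ^ j + 2 * (b * I ^ (3 / 4 : ℝ) * Ebar ^ (3 / 4 : ℝ)) := by
    intro j
    induction j with
    | zero =>
      have := L2 1
      simp only [pow_zero, div_one, add_zero] at this ⊢
      have h0 : 0 ≤ 2 * (b * I ^ (3 / 4 : ℝ) * Ebar ^ (3 / 4 : ℝ)) := by positivity
      linarith
    | succ j ih =>
      have hk : k₁ + 1 + (j + 1) = (k₁ + 1 + j) + 1 := by ring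
      have hEj : E (k₁ + 1 + j) ≤ Ebar := by
        have := L3 j; rwa [show k₁ + j + 1 = k₁ + 1 + j by ring] at this
      have hprod : b * A (k₁ + 1 + j) ^ (3 / 4 : ℝ) * E (k₁ + 1 + j) ^ (3 / 4 : ℝ) ≤
          b * I ^ (3 / 4 : ℝ) * Ebar ^ (3 / 4 : ℝ) :=
        mul_le_mul (mul_le_mul_of_nonneg_left (Real.rpow_le_rpow (hA0 _) (hA _) (by norm_num)) hb)
          (Real.rpow_le_rpow (hE0 _) hEj (by norm_num)) (Real.rpow_nonneg (hE0 _) _) (by positivity)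
      have hs := stepD (k₁ + 1 + j)
      have hdiv : Dbar / 2 ^ (j + 1) = (Dbar / 2 ^ j) / 2 := by rw [pow_succ, div_div]
      rw [hk, hdiv]
      linarith
  -- conclusion
  have hDfin := L4 k₂
  have hDbar2 : Dbar / 2 ^ k₂ ≤ τ / 3 := by
    rw [div_le_iff₀ (by positivity), hDbar]; linarith
  have hEK : 2 * (b * I ^ (3 / 4 : ℝ) * Ebar ^ (3 / 4 : ℝ)) ≤ τ / 3 := by
    have : 2 * (b * I ^ (3 / 4 : ℝ) * Ebar ^ (3 / 4 : ℝ)) =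
        2 * b * I ^ (3 / 4 : ℝ) * Ebar ^ (3 / 4 : ℝ) := by ring
    rw [this, hEbar, hK₁, hDbar]; exact hεK
  have hCfin : C (k₁ + 1 + k₂) ≤ τ / 3 := (hC _).trans hεI
  linarith

/-! ## O4. The constants, chosen once from the tree's existential CKN constants -/

/-- The master-inequality constants packaged as one triple (from `localEnergy_master_scaled`). -/
theorem master_pack : ∃ c : ℝ × ℝ × ℝ, 0 < c.1 ∧ 0 ≤ c.2.1 ∧ 0 ≤ c.2.2 ∧ MasterIneq c.1 c.2.1 c.2.2 := by
  obtain ⟨cT, c1, C4, h1, h2, h3, H⟩ := localEnergy_master_scaled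
  exact ⟨(cT, c1, C4), h1, h2, h3, H⟩

/-- The tree's pressure estimate, as a predicate of its two constants. -/
def PressIneq (κ₅ κ₆ : ℝ≥0) : Prop :=
  ∀ (Q : TopologicalSpace.Opens (ℝ × (EuclideanSpace ℝ (Fin 3)))) (f u : ℝ → (EuclideanSpace ℝ (Fin 3)) → (EuclideanSpace ℝ (Fin 3))) (p : ℝ → (EuclideanSpace ℝ (Fin 3)) → ℝ)
    (G : ℝ → (EuclideanSpace ℝ (Fin 3)) → (EuclideanSpace ℝ (Fin 3)) →L[ℝ] (EuclideanSpace ℝ (Fin 3))), IsSuitableWeakSolutionOn Q 1 f u p →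
    LocallyIntegrableOn (Function.uncurry f) (Q : Set (ℝ × (EuclideanSpace ℝ (Fin 3)))) volume →
    (∀ φ : ℝ → (EuclideanSpace ℝ (Fin 3)) → ℝ, IsSpaceTimeTestOn Q φ → ∫ t, ∫ x, ⟪f t x, gradient (φ t) x⟫_ℝ = 0) →
    HasWeakSpatialGradientOn Q u G →
    ∀ (z : ℝ × (EuclideanSpace ℝ (Fin 3))) (r θ : ℝ), 0 < r → 0 < θ → θ ≤ 1 / 2 →
      closure (parabolicCylinder r z) ⊆ (Q : Set (ℝ × (EuclideanSpace ℝ (Fin 3)))) →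
      cknD (θ * r) z p ≤
        κ₅ * ENNReal.ofReal (θ ^ (-(3 / 2 : ℝ))) * cknAEss r z u ^ (3 / 4 : ℝ) *
            cknE r z G ^ (3 / 4 : ℝ) +
        κ₆ * ENNReal.ofReal θ * cknD r z p

/-- The pressure-estimate constants packaged as one pair (from the tree's `pressureEstimate_holds`). -/
theorem press_pack : ∃ κ : ℝ≥0 × ℝ≥0, PressIneq κ.1 κ.2 := by
  obtain ⟨κ₅, κ₆, H⟩ := pressureEstimate_holds
  exact ⟨(κ₅, κ₆), H⟩

/-- The tree's backward one-scale ε-regularity criterion (vertex allowed), as a predicate. -/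
def RegIneq (ε₀ C₀ : ℝ) : Prop :=
  ∀ (Q : TopologicalSpace.Opens (ℝ × (EuclideanSpace ℝ (Fin 3)))) (q : ℝ) (u : ℝ → (EuclideanSpace ℝ (Fin 3)) → (EuclideanSpace ℝ (Fin 3))) (p : ℝ → (EuclideanSpace ℝ (Fin 3)) → ℝ)
    (G : ℝ → (EuclideanSpace ℝ (Fin 3)) → (EuclideanSpace ℝ (Fin 3)) →L[ℝ] (EuclideanSpace ℝ (Fin 3))), 1 ≤ q → IsLRSuitableWeakSolutionOn Q 1 q 0 u p G →
    ∀ (z₀ : ℝ × (EuclideanSpace ℝ (Fin 3))) (r₀ l : ℝ), 0 < r₀ →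
      parabolicCylinder r₀ z₀ ⊆ (Q : Set (ℝ × (EuclideanSpace ℝ (Fin 3)))) → 0 ≤ l → l ≤ ε₀ →
      ∫⁻ w in parabolicCylinder r₀ z₀, (‖u w.1 w.2‖ₑ ^ (3 : ℕ) + ‖p w.1 w.2‖ₑ ^ (3 / 2 : ℝ)) ≤
        ENNReal.ofReal (l ^ 3 * r₀ ^ 2) →
      ∀ᵐ w ∂(volume.restrict (parabolicCylinder (r₀ / 2) z₀)), ‖u w.1 w.2‖ ≤ C₀ * l / r₀

/-- The backward one-scale ε-regularity constants packaged as one pair (from the tree's `unforced_epsilonRegularity_of_theorem15_3 RRS2016.theorem15_3_holds`). -/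
theorem reg_pack : ∃ e : ℝ × ℝ, 0 < e.1 ∧ 0 < e.2 ∧ RegIneq e.1 e.2 := by
  obtain ⟨ε₀, C₀, h1, h2, H⟩ := unforced_epsilonRegularity_of_theorem15_3 RRS2016.theorem15_3_holds
  exact ⟨(ε₀, C₀), h1, h2, H⟩

/-- The CKN master constant `cT` (chosen once from `master_pack`). -/
noncomputable def cT : ℝ := (Classical.choose master_pack).1
/-- The CKN master constant `c1` (chosen once from `master_pack`). -/
noncomputable def c1 : ℝ := (Classical.choose master_pack).2.1
/-- The CKN master constant `C4` (chosen once from `master_pack`). -/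
noncomputable def C4 : ℝ := (Classical.choose master_pack).2.2
/-- The pressure-estimate constant `κ₅` (chosen once from `press_pack`). -/
noncomputable def κ₅ : ℝ≥0 := (Classical.choose press_pack).1
/-- The pressure-estimate constant `κ₆` (chosen once from `press_pack`). -/
noncomputable def κ₆ : ℝ≥0 := (Classical.choose press_pack).2
/-- The ε-regularity threshold `ε₀` (chosen once from `reg_pack`). -/
noncomputable def ε₀ : ℝ := (Classical.choose reg_pack).1
/-- The ε-regularity bound constant `C₀` (chosen once from `reg_pack`). -/
noncomputable def C₀ : ℝ := (Classical.choose reg_pack).2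

/-- `0 < cT`. -/
theorem cT_pos : 0 < cT := (Classical.choose_spec master_pack).1
/-- `0 ≤ c1`. -/
theorem c1_nonneg : 0 ≤ c1 := (Classical.choose_spec master_pack).2.1
/-- `0 ≤ C4`. -/
theorem C4_nonneg : 0 ≤ C4 := (Classical.choose_spec master_pack).2.2.1
/-- The master inequality holds with the chosen constants: `MasterIneq cT c1 C4`. -/
theorem master : MasterIneq cT c1 C4 := (Classical.choose_spec master_pack).2.2.2
/-- The pressure estimate holds with the chosen constants: `PressIneq κ₅ κ₆`. -/
theorem press : PressIneq κ₅ κ₆ := Classical.choose_spec press_pack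
/-- `0 < ε₀`. -/
theorem ε₀_pos : 0 < ε₀ := (Classical.choose_spec reg_pack).1
/-- `0 < C₀`. -/
theorem C₀_pos : 0 < C₀ := (Classical.choose_spec reg_pack).2.1
/-- The ε-regularity criterion holds with the chosen constants: `RegIneq ε₀ C₀`. -/
theorem reg : RegIneq ε₀ C₀ := (Classical.choose_spec reg_pack).2.2

/-- The scale ratio: `θ₀ ≤ 1/2` and `κ₆ θ₀ ≤ 1/2` (pressure contraction). -/
noncomputable def θ₀ : ℝ := min (1 / 2) (1 / (2 * ((κ₆ : ℝ) + 1)))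

/-- `0 < θ₀`. -/
theorem θ₀_pos : 0 < θ₀ := lt_min (by norm_num) (by positivity)
/-- `θ₀ ≤ 1/2`. -/
theorem θ₀_le_half : θ₀ ≤ 1 / 2 := min_le_left _ _
/-- `θ₀ < 1`. -/
theorem θ₀_lt_one : θ₀ < 1 := θ₀_le_half.trans_lt (by norm_num)
/-- Pressure contraction at ratio `θ₀`: `κ₆ θ₀ ≤ 1/2`. -/
theorem κ₆_mul_θ₀_le : (κ₆ : ℝ) * θ₀ ≤ 1 / 2 := by
  have hk : (0 : ℝ) ≤ κ₆ := κ₆.coe_nonneg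
  have h1 : (κ₆ : ℝ) * θ₀ ≤ κ₆ * (1 / (2 * ((κ₆ : ℝ) + 1))) :=
    mul_le_mul_of_nonneg_left (min_le_right _ _) hk
  refine h1.trans ?_
  rw [mul_one_div, div_le_iff₀ (by positivity)]
  nlinarith

/-- The `E`-step and `D`-step coefficients at ratio `θ₀`, and the target `τ₀ = ε₀³`. -/
noncomputable def a₁ : ℝ := 2 * cT * (cT * θ₀ ^ 2 * c1)
/-- The `E`-step coefficient `a₂ = 2cT·(cT C4 θ₀⁻²)`. -/
noncomputable def a₂ : ℝ := 2 * cT * (cT * C4 * (θ₀ ^ 2)⁻¹)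
/-- The `E`-step coefficient `a₃ = 2cT·(2cT θ₀⁻²)`. -/
noncomputable def a₃ : ℝ := 2 * cT * (2 * cT * (θ₀ ^ 2)⁻¹)
/-- The `D`-step coefficient `b₁ = κ₅ θ₀^{-3/2} + 1`. -/
noncomputable def b₁ : ℝ := (κ₅ : ℝ) * θ₀ ^ (-(3 / 2 : ℝ)) + 1
/-- The target smallness `τ₀ = ε₀³`. -/
noncomputable def τ₀ : ℝ := ε₀ ^ 3

/-- `0 ≤ a₁`. -/
theorem a₁_nonneg : 0 ≤ a₁ := by
  have := cT_pos; have := c1_nonneg; unfold a₁; positivity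
/-- `0 ≤ a₂`. -/
theorem a₂_nonneg : 0 ≤ a₂ := by
  have := cT_pos; have := C4_nonneg; have := θ₀_pos; unfold a₂; positivity
/-- `0 ≤ a₃`. -/
theorem a₃_nonneg : 0 ≤ a₃ := by
  have := cT_pos; have := θ₀_pos; unfold a₃; positivity
/-- `0 < b₁`. -/
theorem b₁_pos : 0 < b₁ := by
  have h : (0 : ℝ) ≤ (κ₅ : ℝ) * θ₀ ^ (-(3 / 2 : ℝ)) :=
    mul_nonneg κ₅.coe_nonneg (Real.rpow_nonneg θ₀_pos.le _)
  unfold b₁; linarith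
/-- `κ₅ θ₀^{-3/2} ≤ b₁`. -/
theorem κ₅_le_b₁ : (κ₅ : ℝ) * θ₀ ^ (-(3 / 2 : ℝ)) ≤ b₁ := by unfold b₁; linarith
/-- `0 < τ₀`. -/
theorem τ₀_pos : 0 < τ₀ := by have := ε₀_pos; unfold τ₀; positivity

/-- `K₁(J) = a₁ (2J)^{1/3} + a₂ J + a₃ (3 b₁ J^{3/2})^{2/3}` (the bracket of the `E`-step in the box). -/
noncomputable def K₁ (J : ℝ) : ℝ :=
  a₁ * (2 * J) ^ (1 / 3 : ℝ) + a₂ * J + a₃ * (3 * b₁ * J ^ (3 / 2 : ℝ)) ^ (2 / 3 : ℝ)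

/-- `0 ≤ K₁ J` for `0 ≤ J`. -/
theorem K₁_nonneg {J : ℝ} (hJ : 0 ≤ J) : 0 ≤ K₁ J := by
  have := a₁_nonneg; have := a₂_nonneg; have := a₃_nonneg; have := b₁_pos
  unfold K₁; positivity

/-- **THE EXPLICIT FLOOR** `ε_*(I)`: with `J = max I 1`,
`ε_*(I) = min {1, τ₀/(6J), ((τ₀/3) / ((2 b₁ J^{3/4} + 1)(K₁(J) + 1)^{3/4}))⁴ / (2J)}` — a closed
form in `I` and the tree's CKN constants `cT, c1, C4, κ₅, κ₆, ε₀`. -/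
noncomputable def epsFloor (I : ℝ) : ℝ :=
  min 1 (min (τ₀ / (6 * max I 1))
    (((τ₀ / 3) / ((2 * b₁ * (max I 1) ^ (3 / 4 : ℝ) + 1) * (K₁ (max I 1) + 1) ^ (3 / 4 : ℝ))) ^ 4 /
      (2 * max I 1)))

/-- The floor is positive: `0 < ε_*(I)`. -/
theorem epsFloor_pos (I : ℝ) : 0 < epsFloor I := by
  have hJ : 1 ≤ max I 1 := le_max_right _ _
  have hJ0 : 0 < max I 1 := by linarith
  have := τ₀_pos; have := b₁_pos; have hK := K₁_nonneg hJ0.le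
  unfold epsFloor
  refine lt_min one_pos (lt_min (by positivity) ?_)
  positivity

/-- What `ε ≤ ε_*(I)` buys: the three smallness conditions of the scheme (with `J = max I 1`). -/
theorem epsFloor_spec {I ε : ℝ} (hε0 : 0 ≤ ε) (hε : ε ≤ epsFloor I) :
    ε ≤ 1 ∧ 2 * ε * max I 1 ≤ τ₀ / 3 ∧
      2 * b₁ * (max I 1) ^ (3 / 4 : ℝ) *
        ((2 * ε * max I 1) ^ (1 / 3 : ℝ) * K₁ (max I 1)) ^ (3 / 4 : ℝ) ≤ τ₀ / 3 := by
  set J := max I 1 with hJdef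
  have hJ : 1 ≤ J := le_max_right _ _
  have hJ0 : 0 < J := by linarith
  have hτ := τ₀_pos; have hb := b₁_pos; have hK := K₁_nonneg hJ0.le
  have h1 : ε ≤ 1 := hε.trans (min_le_left _ _)
  have h2 : ε ≤ τ₀ / (6 * J) := hε.trans ((min_le_right _ _).trans (min_le_left _ _))
  have h3 : ε ≤ ((τ₀ / 3) / ((2 * b₁ * J ^ (3 / 4 : ℝ) + 1) * (K₁ J + 1) ^ (3 / 4 : ℝ))) ^ 4 /
      (2 * J) := hε.trans ((min_le_right _ _).trans (min_le_right _ _))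
  refine ⟨h1, ?_, ?_⟩
  · rw [le_div_iff₀ (by positivity)] at h2; linarith
  · set M := 2 * b₁ * J ^ (3 / 4 : ℝ) + 1 with hM
    set N := K₁ J + 1 with hN
    have hM0 : 0 < M := by rw [hM]; positivity
    have hN0 : 0 < N := by rw [hN]; linarith
    set X := (τ₀ / 3) / (M * N ^ (3 / 4 : ℝ)) with hX
    have hX0 : 0 < X := by rw [hX]; positivity
    -- `(2 ε J)^{1/4} ≤ X`
    have h2εJ : 2 * ε * J ≤ X ^ 4 := by
      rw [le_div_iff₀ (by positivity)] at h3; linarith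
    have hq : (2 * ε * J) ^ (1 / 4 : ℝ) ≤ X := by
      have := Real.rpow_le_rpow (by positivity) h2εJ (by norm_num : (0 : ℝ) ≤ 1 / 4)
      rwa [show (X ^ 4 : ℝ) = X ^ ((4 : ℕ) : ℝ) by rw [Real.rpow_natCast], ← Real.rpow_mul hX0.le,
        show ((4 : ℕ) : ℝ) * (1 / 4) = 1 by norm_num, Real.rpow_one] at this
    -- expand the `3/4` power
    have hexp : ((2 * ε * J) ^ (1 / 3 : ℝ) * K₁ J) ^ (3 / 4 : ℝ) =
        (2 * ε * J) ^ (1 / 4 : ℝ) * K₁ J ^ (3 / 4 : ℝ) := by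
      rw [Real.mul_rpow (Real.rpow_nonneg (by positivity) _) hK, ← Real.rpow_mul (by positivity)]
      norm_num
    rw [hexp]
    have hKN : K₁ J ^ (3 / 4 : ℝ) ≤ N ^ (3 / 4 : ℝ) :=
      Real.rpow_le_rpow hK (by rw [hN]; linarith) (by norm_num)
    have hbM : 2 * b₁ * J ^ (3 / 4 : ℝ) ≤ M := by rw [hM]; linarith
    calc 2 * b₁ * J ^ (3 / 4 : ℝ) * ((2 * ε * J) ^ (1 / 4 : ℝ) * K₁ J ^ (3 / 4 : ℝ))
        ≤ M * (X * N ^ (3 / 4 : ℝ)) := by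
          apply mul_le_mul hbM (mul_le_mul hq hKN (Real.rpow_nonneg hK _) hX0.le)
            (by positivity) hM0.le
      _ = τ₀ / 3 := by
          rw [hX]; field_simp

end Summit.NavierStokesRegularity.NavierStokesRegularity.Cruxes.ScarEnvelopeTypeI.ZoomDictionary.Floor
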